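import Summits.QuantumFields.YangMills.Theorems.IR.BlockedActivityWDecay
import Summits.QuantumFields.YangMills.Theorems.IR.BlockedActivityWTolerant
import HarnessLib

/-!
# Crux `IR` (stmt-QuantumFields-19354), lane B «strong coupling AFTER BLOCKING»: the onset ∕ supplier statement in the DECAY currency and its
# target BY NAME (`… → SharpOnset.IRNSC → Theses.BalabanLadder.IR`)

Helper module for item `stmt-QuantumFields-19354` (`--supports`; it closes nothing), lane `ym-19354-onsetsc-p2` (g2).

With the distance-sensitive reduction of `Theorems/IR/BlockedActivityWDecay` the activity the weak side must deliver is no longer tied to the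
accuracy `ε` of the onset format: the supplier chooses an admissible `(n, ε)` and a decay room `τ ≥ 0` with
`decayBound τ n = 664 e^{2+τ} e^{−τ(2n+1)} ≤ ε`, and owes the LOCAL W|Typ class at the per-cell radius `radiusDecay τ = 1∕(2 e^{1+τ} 83²)`
(e.g. `(n, ε, τ) = (12, decayBound 1 12, 1)`, `admissible_twelve`, radius `r_C ≈ 9.82·10⁻⁶`).

* `BlockedActivityDecayAct ρ β w n ε Typ := ∃ τ ≥ 0, decayBound τ n ≤ ε ∧ BlockedActivityTypWLocAll ρ β w n (radiusDecay τ) Typ` — the `Act`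
  of cplan's hereditary supplier glue (6d) in the decay currency (level `= ε` itself), with the TOTAL adapter
  `clauseIAll_of_blockedActivityDecayAct : BlockedActivityDecayAct ρ β w n ε Typ → ClauseIAll ρ β w n ε Typ`;
* **`BlockedActivityTypOnsetDecaySCG`** — the GUARDED (owner R118 (2): `1 ≤ ℓ₀ ∧ 3 ≤ R ∧ 0 < θ`) W|Typ, NT-calibrated, insertion-tolerant
  construction statement with the activity conjunct `BlockedActivityDecayAct r.ρ β w n ε Typ` in place of
  `BlockedActivityTypWAll r.ρ β w n (radiusT ε) Typ` (target of record `BlockedActivityTypOnsetCalSCWTolG`, p542635);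
* **`ir_of_blockedActivityTypOnsetDecaySCG : BlockedActivityTypOnsetDecaySCG → SharpOnset.IRNSC → Theses.BalabanLadder.IR`** (no X-stub; cplan
  (6d) `ir_of_activitySupplierHereditarySharpSC` with `Act := BlockedActivityDecayAct`, `r₀ n ε := ε`).
Relation to the target of record: neither implies the other — the decay statement asks a LARGER radius (`radiusDecay τ`, ε-free) of a
SMALLER class (locality `local_g` added); both are inhabited at strong coupling by the calibrations.  Which one is «of record» is the owner's call.

HONEST FRAMING: an OPEN construction statement of a CONDITIONAL chain and its by-name reduction; nothing asserts weak-coupling mixing, a gap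
or Clay.  No `sorry`; axioms ⊆ {propext, Classical.choice, Quot.sound}; no instances, no notation.
-/

set_option autoImplicit false

noncomputable section

open Filter Topology MeasureTheory
open Literature.MathematicalPhysics.QuantumFieldTheory Literature.MathematicalPhysics.QuantumLattice
open Summit.QuantumFields.YangMills.Cruxes.OSLegsFromFemtoAndGap.DlrCollarTransfer (LowerBounds)
open Summit.QuantumFields.YangMills.Cruxes.IR.OnsetFormats (shellCount)
open Summit.QuantumFields.YangMills.Cruxes.IR.AfPincerUc (ClauseIAll IsFrame TypLocal ClauseIIukp ClauseIII)
open Summit.QuantumFields.YangMills.Cruxes.IR.AfPincerUc.SharpOnset (IRNSC ir_of_activitySupplierHereditarySharpSC)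
open Summit.QuantumFields.YangMills.Cruxes.IR.AfPincerUc.SharpLanes (InsertionTolerant)

namespace Summit.QuantumFields.YangMills.Cruxes.IR.BlockedActivity

section Act

variable {G : Type} [Group G] [TopologicalSpace G] [IsTopologicalGroup G] [CompactSpace G]
  [MeasurableSpace G] [BorelSpace G] {N : ℕ}

/-- **The activity predicate of the decay currency** (level `ε`): SOME decay room `τ ≥ 0` with window accuracy `decayBound τ n ≤ ε` and the
LOCAL W|Typ class at every centre at the per-cell radius `radiusDecay τ`. -/
def BlockedActivityDecayAct (ρ : G →* Matrix (Fin N) (Fin N) ℂ) (β : ℝ) (w : Fin 4 → ℤ → ℤ) (n : ℕ) (ε : ℝ)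
    (Typ : Cell → Set (LGConfig 4 G)) : Prop :=
  ∃ τ : ℝ, 0 ≤ τ ∧ decayBound τ n ≤ ε ∧ BlockedActivityTypWLocAll ρ β w n (radiusDecay τ) Typ

/-- **The adapter (total in `(n, ε)`)**: `BlockedActivityDecayAct ρ β w n ε Typ → ClauseIAll ρ β w n ε Typ`
(`clauseIAll_of_blockedActivityTypWLocAll_radiusDecay`). -/
theorem clauseIAll_of_blockedActivityDecayAct {ρ : G →* Matrix (Fin N) (Fin N) ℂ} {β : ℝ} {w : Fin 4 → ℤ → ℤ} {n : ℕ} {ε : ℝ}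
    {Typ : Cell → Set (LGConfig 4 G)} (h : BlockedActivityDecayAct ρ β w n ε Typ) : ClauseIAll ρ β w n ε Typ := by
  obtain ⟨τ, hτ, hε, hC⟩ := h
  exact clauseIAll_of_blockedActivityTypWLocAll_radiusDecay hC hτ le_rfl hε

/-- The instance of record of the decay room: at window `12`, `τ = 1` and radius `radiusDecay 1 ≈ 9.82·10⁻⁶` the predicate holds at the
admissible level `decayBound 1 12`. -/
theorem blockedActivityDecayAct_twelve {ρ : G →* Matrix (Fin N) (Fin N) ℂ} {β : ℝ} {w : Fin 4 → ℤ → ℤ}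
    {Typ : Cell → Set (LGConfig 4 G)} (hC : BlockedActivityTypWLocAll ρ β w 12 (radiusDecay 1) Typ) :
    BlockedActivityDecayAct ρ β w 12 (decayBound 1 12) Typ :=
  ⟨1, zero_le_one, le_rfl, hC⟩

end Act

/-- **Lane B in the DECAY currency — W|Typ, LOCAL, NT-calibrated, insertion tolerant, GUARDED**: for every simply connected compact simple
`G`, lattice representation `r` and NT unit map `a` with the floors, an admissible `(n, ε)` and `β`-independent `ℓ₀ ≥ 1`, `R ≥ 3`, `θ > 0`
such that for every `δ > 0`, beyond `β₂(δ)`, SOME mesh `b` with `a(β) · b < T(δ)`, `R ≤ b` carries on every mesh-`b` frame a cell-local,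
insertion-tolerant class `Typ` with `BlockedActivityDecayAct r.ρ β w n ε Typ` (∃ decay room `τ ≥ 0`: `decayBound τ n ≤ ε` and the local
W|Typ class at radius `radiusDecay τ`) and the UKP rarity ∕ torus-anchor clauses (ii), (iii).  OPEN research content; not asserted. -/
def BlockedActivityTypOnsetDecaySCG : Prop :=
  ∀ (G : Type) [Group G] [TopologicalSpace G] [IsTopologicalGroup G] [CompactSpace G],
    IsCompactSimpleLieGroup G → SimplyConnectedSpace G →
    letI : MeasurableSpace G := borel G; haveI : BorelSpace G := ⟨rfl⟩;
    ∀ (r : LatticeRep G) (a : ℝ → ℝ), (∀ β, 0 < a β) → Tendsto a atTop (𝓝 0) → LowerBounds G r a →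
      ∃ (n : ℕ) (ε : ℝ), 1 ≤ n ∧ 0 ≤ ε ∧ ε * shellCount n ≤ 3 / 4 ∧
        ∃ (ℓ₀ R : ℕ) (θ : ℝ), 1 ≤ ℓ₀ ∧ 3 ≤ R ∧ 0 < θ ∧
          ∀ δ : ℝ, 0 < δ → ∃ T β₂ : ℝ, ∀ β : ℝ, β₂ ≤ β → ∃ b : ℕ, 1 ≤ b ∧ a β * (b : ℝ) < T ∧ R ≤ b ∧
            ∀ w : Fin 4 → ℤ → ℤ, IsFrame b w → ∃ Typ : (Fin 4 → ℤ) → Set (LGConfig 4 G),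
              TypLocal w Typ ∧ InsertionTolerant r.ρ w θ R ℓ₀ Typ ∧ BlockedActivityDecayAct r.ρ β w n ε Typ ∧
                ClauseIIukp r.ρ β w δ Typ ∧ ClauseIII r.ρ β w b δ Typ

/-- **Lane B (decay currency) ∧ R_NSC ⇒ the route decl `IR`** (no X-stub): cplan (6d) `ir_of_activitySupplierHereditarySharpSC` with
`Act := BlockedActivityDecayAct` and `r₀ n ε := ε`, after forgetting the guard and the tolerance conjunct. -/
theorem ir_of_blockedActivityTypOnsetDecaySCG (h : BlockedActivityTypOnsetDecaySCG) (hN : IRNSC) :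
    Summit.QuantumFields.YangMills.Theses.BalabanLadder.IR := by
  refine ir_of_activitySupplierHereditarySharpSC (Act := @BlockedActivityDecayAct) (r₀ := fun _ ε => ε)
    (hadapt := fun _ _ _ _ _ _ hA => clauseIAll_of_blockedActivityDecayAct hA) ?_ hN
  intro G _ _ _ _ hG hsc
  letI : MeasurableSpace G := borel G
  haveI : BorelSpace G := ⟨rfl⟩
  intro r a ha hat hlb
  obtain ⟨n, ε, hn, hε, hM, ℓ₀, R, θ, -, -, -, hrest⟩ := h G hG hsc r a ha hat hlb
  refine ⟨n, ε, hn, hε, hM, fun δ hδ => ?_⟩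
  obtain ⟨T, β₂, hβ⟩ := hrest δ hδ
  refine ⟨T, β₂, fun β hb => ?_⟩
  obtain ⟨b, hb1, hlt, -, hw⟩ := hβ β hb
  refine ⟨b, hb1, hlt, fun w hwf => ?_⟩
  obtain ⟨Typ, hloc, -, hact, hii, hiii⟩ := hw w hwf
  exact ⟨Typ, hloc, hact, hii, hiii⟩

end Summit.QuantumFields.YangMills.Cruxes.IR.BlockedActivity

end
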